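import Summits.BirchSwinnertonDyer.BirchSwinnertonDyer.Theorems.KimAtThreeDeepLowerOffStratumSockets
import HarnessLib

/-!
# Route `KimAtThreeKolyvagin` (rung W2), crux `DeepLowerAtThreeOffKatoStratum` (item 19679) on its
# NON-ADDITIVE rows, in the crux's OWN currency (registered stub `stub_nonAdditive` of the BC3 skeleton):
# the stub VERBATIM from two displayed residual families; OUTRIGHT by name on the covered rows with
# `3 ∤ ∏ c_ℓ`; on the covered rows the stub IS «Tamagawa divisibility of deep Kurihara numbers»

Cell `bsd-addord`, seat `bsd-addord-w2-acc2` (PROGRAMME PART 1b, ACCEL-LIST row (2)), item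
`stmt-BirchSwinnertonDyer-19679` (BC3 skeleton `DeepLowerAtThreeOffKatoStratum_birth.lean`, sha16
`e575d03075635394`: `stub_nonAdditive` / `stub_additiveDefect` → `DeepLowerAtThreeOffKatoStratum_of`; the
owner assembles). LOWER-side mirror of w2-c5's `KimAtThreeDeepUpperNonAdditiveRows` §4 (crux 19562) and the
optimal-datum form of w2-c2's `KimAtThreeDeepLowerNonAdditiveRows` (crux 19075); the row sockets are in the
companion file `KimAtThreeDeepLowerOffStratumSockets` (notation `a, d, s, c` there). Theorems only; every
printed input is a hypothesis BY NAME; the residual families are DISPLAYED hypotheses; nothing asserted;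
the crux stays OPEN.

The crux's currency: `W₀` with the `3`-adic tower onto, `Ш` finite, a lattice-optimal degree-minimal
parametrisation datum `D₀` at `N = N_E` with `3`-integral plus symbols and `ord(δ̃) = 0`, `¬ Addv W₀ 3`.
There the `3`-adic period transfer `Ω(W₀) = u·Ω⁺_{D₀.f}`, `|u|₃ = 1`, is FREE (`¬ Addv ⇒ 9 ∤ N ⇒ 3 ∤ c_{D₀}`
by Mazur 1978 Cor. 4.1 `hM`; w2-c4's `periodTransfer_three_of_optimal_of_not_addv`), so the sockets apply:

* ★ `stub_nonAdditive_of_missingLowerBoundAt_of_tamagawa_le_deepInfty` — the registered stub VERBATIM from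
  `hM`, GZK and TWO DISPLAYED residual families on the non-additive tower rows of analytic rank `0`:
  (L) Miller's lower half `MissingLowerBoundAt W 3` (discharged BY NAME on row C1 = good-ordinary-or-
  multiplicative with (ram) [Skinner 2016 Thm. C, or numbered theorems Skinner–Urban 3.6.9 + Skinner
  Thm. A + Greenberg 4.1 + Mazur Cor. 4.1 + …] and on row C16 = good ordinary surj(3) [Yan–Zhu 2026];
  OPEN at good SUPERSINGULAR `3` — corners X6/X7/X8 at `3` — and at multiplicative `3` WITHOUT (ram) —
  corner X11a at `3`); (TD) TamDiv-deep `v₃(∏ c_ℓ) ≤ ∂^{(∞)}_{deep}(δ̃)` on the rows with `3 ∣ ∏ c_ℓ` (Kim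
  2022 Conj. 1.10 `≥` half, deep reading; OPEN at `3`).
* ★ `stub_nonAdditive_covered_of_tamagawa_le_deepInfty` — the stub on the C1 ∪ C16 sub-rows (ORDINARY if
  good, (ram) if multiplicative) from SIX named facts (`hYZ`, `hW20`, `hSk`, `hmod`, `hGZK`, `hM`) + (TD);
  ★ `stub_nonAdditive_covered_of_not_three_dvd_tamagawa` — OUTRIGHT (named facts only, no open
  hypothesis) on those sub-rows when `3 ∤ ∏ c_ℓ`; ★ `stub_nonAdditive_rowC1_of_mainConjectures_of_mazur` —
  the row-C1 sub-rows from NUMBERED theorems only (+ (TD)); PUB* token `SU14-12.3.6-mu@nonsplit@3` (R-01).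
* `tamagawa_le_deepInfty_of_stubRow_covered` — necessity: on C1 ∪ C16 the stub's row conclusion IMPLIES
  (TD); so on every covered row the registered stub is EQUIVALENT to (TD) — its exact residue there.
* §2 `deepTwins_iff_deepInfty_eq_tamagawa_of_missingPPartAt` / `deepTwins_covered_iff_deepInfty_eq_tamagawa`:
  GIVEN `BSD₃` at the row (by name on C1 ∪ C16) the two deep stubs of 19679 / 19562 TOGETHER ⟺
  `∂^{(∞)}_{deep}(δ̃) = v₃(∏ c_ℓ)` — Kim's Conj. 1.10 (deep reading), exactly.
RESIDUE OF THE STUB, typed: (L) on good-supersingular-`3` and multiplicative-without-(ram) tower rows of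
analytic rank `0`; (TD) on the `3 ∣ ∏ c_ℓ` rows. Print results on the Tamagawa defect (Büyükboduk 2009,
BCGS 2026) concern Kato's KOLYVAGIN SYSTEM and reach `δ̃` only through the (untyped) good-reduction
Kato–Kurihara dictionary at `3`; Kim AJM 148 Thm. 1.9 is `p ≥ 5`; Kim 2025 Thm. 1.1 is announced.
[cite: Skinner2016PacificMC, Thm. C (§1), Thm. A] [cite: SkinnerUrban2014, Thm. 3.6.9 (p. 45)]
[cite: GreenbergLNM1716, Thm. 4.1 (p. 102)] [cite: Mazur1978, Cor. 4.1] [cite: YanZhu2024MainConjNonCM, Thm. 4.15 (§4.6)]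
[cite: Wuthrich2014, Lemma 20 (p. 399)] [cite: Miller2011LMS, Def. 1.1]
[cite: Kim2022StructureSelmer, §1.5.1, Conj. 1.10 (PDF pp. 7–8), Thm. 1.9 (6)] [cite: Kim2025RefinedTNC, Thm. 1.1]
-/

set_option autoImplicit false
-- the Theorems namespace of a single-conjunct summit repeats the summit name by design (D-0017)
set_option linter.dupNamespace false

noncomputable section

open scoped MatrixGroups ModularForm Classical

open CongruenceSubgroup WeierstrassCurve Literature.NumberTheory.EllipticCurves
  Literature.NumberTheory.EllipticCurves.ModularForms
  Literature.NumberTheory.EllipticCurves.Rank1Residual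
  Literature.NumberTheory.EllipticCurves.Rank1Residual.Typed
  Literature.NumberTheory.EllipticCurves.Skinner2016
  Literature.NumberTheory.EllipticCurves.SteinWuthrich2013
  Summit.BirchSwinnertonDyer.BirchSwinnertonDyer.Theorems.Rank1ResidualX1Defs

namespace Summit.BirchSwinnertonDyer.BirchSwinnertonDyer.Theorems.KimAtThreeDeepLowerOffStratumNonAdditiveRows

open Summit.BirchSwinnertonDyer.Rank1Residual
open Summit.BirchSwinnertonDyer.BirchSwinnertonDyer.Theses.KimAtThreeKolyvagin
open Summit.BirchSwinnertonDyer.BirchSwinnertonDyer.Theorems.KimAtThreeKolyvaginUnitLevelOneRungs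
open Summit.BirchSwinnertonDyer.BirchSwinnertonDyer.Theorems.KimAtThreeDeepLowerSmallDefect
open Summit.BirchSwinnertonDyer.BirchSwinnertonDyer.Theorems.KimAtThreeDeepLowerNonAdditiveRows
open Summit.BirchSwinnertonDyer.BirchSwinnertonDyer.Theorems.KimAtThreeShallowEqDeepOffStratumSockets
open Summit.BirchSwinnertonDyer.BirchSwinnertonDyer.Theorems.KimAtThreeShallowEqDeepOffStratumNonAdditiveRows

open Summit.BirchSwinnertonDyer.BirchSwinnertonDyer.Theorems.KimAtThreeDeepLowerOffStratumSockets

/-! ### §1 The crux's own currency: optimal datum at the conductor, `¬ Addv W₀ 3` -/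

/-- ★ **The registered stub `stub_nonAdditive` of crux 19679, VERBATIM, from Mazur 1978 Cor. 4.1 (`hM`),
GZK (`hGZK`) and TWO DISPLAYED residual families on the non-additive tower rows of analytic rank `0`**:
(L) the LOWER half of `BSD₃` (`MissingLowerBoundAt W 3`; §3 discharges it on good-ORDINARY rows and on
multiplicative rows with (ram); OPEN at good supersingular `3` — corners X6/X7/X8 of the partition at
`p = 3` — and at multiplicative `3` without (ram) — corner X11a at `3`), (TD) TamDiv-deep
`v₃(∏ c_ℓ) ≤ ∂^{(∞)}_{deep}(δ̃)` on the rows with `3 ∣ ∏ c_ℓ` (OPEN; by §1 also NECESSARY given `BSD₃`).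
The period transfer is discharged at the optimal datum (`periodTransfer_three_of_optimal_of_not_addv`:
`¬ Addv ⇒ 9 ∤ N ⇒ 3 ∤ c_{D₀}`), then p426576's `deepLower_conclusion_of_missingLowerBoundAt_of_tamagawa_le_deepInfty`.
[cite: Mazur1978, Cor. 4.1] [cite: Miller2011LMS, Def. 1.1] [cite: Kim2022StructureSelmer, Conj. 1.10 (PDF p. 8), Thm. 1.9 (6)] -/
theorem stub_nonAdditive_of_missingLowerBoundAt_of_tamagawa_le_deepInfty
    (hM : mazur_not_dvd_maninConstant_of_odd)
    (hGZK : rank_eq_analyticRank_of_analyticRank_le_one)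
    (hL : ∀ (W : WeierstrassCurve ℚ) [W.IsElliptic] [W.IsGloballyMinimal],
      (∀ n : ℕ, W.HasSurjectiveModNGaloisRep (3 ^ n : ℕ)) → W.analyticRank = 0 →
      ¬ (haveI : Fact (Nat.Prime 3) := ⟨Nat.prime_three⟩; Addv W 3) → MissingLowerBoundAt W 3)
    (hTD : ∀ (W : WeierstrassCurve ℚ) [W.IsElliptic] [W.IsGloballyMinimal],
      (∀ n : ℕ, W.HasSurjectiveModNGaloisRep (3 ^ n : ℕ)) →
      ∀ {N : ℕ} [NeZero N] (f : CuspForm (Gamma0 N) 2), IsNewformOf W f →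
      kuriharaVanishingOrder W 3 f = 0 →
      ¬ (haveI : Fact (Nat.Prime 3) := ⟨Nat.prime_three⟩; Addv W 3) → 3 ∣ W.tamagawaProduct →
        ((padicValNat 3 W.tamagawaProduct : ℕ) : ℕ∞) ≤ kuriharaPartialDeepInfty W 3 f) :
    ∀ (W₀ : WeierstrassCurve ℚ) [W₀.IsElliptic] [W₀.IsGloballyMinimal],
      (∀ n : ℕ, W₀.HasSurjectiveModNGaloisRep (3 ^ n : ℕ)) → Finite W₀.sha →
      ∀ {N : ℕ} [NeZero N], N = W₀.conductorNorm ℤ →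
      ∀ (D₀ : ModularParametrizationData W₀ N),
        (∀ z ∈ D₀.L.lattice, ∃ w ∈ periodLattice D₀.f, z = D₀.c * w) →
        (∀ (W₂ : WeierstrassCurve ℚ) [W₂.IsElliptic] (D₂ : ModularParametrizationData W₂ N),
          D₂.f = D₀.f → D₀.modularDegree ≤ D₂.modularDegree) →
        (∀ r : ℚ, ratPlusSymbol D₀.f r ≠ 0 → 0 ≤ padicValRat 3 (ratPlusSymbol D₀.f r)) →
        kuriharaVanishingOrder W₀ 3 D₀.f = 0 →
        ¬ (haveI : Fact (Nat.Prime 3) := ⟨Nat.prime_three⟩; Addv W₀ 3) →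
        ∃ d : ℕ, kuriharaPartialDeepInfty W₀ 3 D₀.f = d ∧
          kuriharaPartial W₀ 3 D₀.f 0 ≤
            ((padicValNat 3 (Nat.card (AddCommGroup.primaryComponent W₀.sha 3)) + d : ℕ) : ℕ∞) := by
  intro W₀ _ _ htower _ N _ hN D₀ hopt _ _ hord hnA
  haveI : Fact (Nat.Prime 3) := ⟨Nat.prime_three⟩
  have hf : IsNewformOf W₀ D₀.f := D₀.isNewformOf
  have hr0 : W₀.analyticRank = 0 := analyticRank_eq_zero_of_kuriharaVanishingOrder_eq_zero W₀ D₀.f hf hord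
  have hirr : W₀.HasIrreducibleModPGaloisRep 3 :=
    hasIrreducibleModPGaloisRep_of_hasSurjectiveModNGaloisRep W₀ 3 (by simpa using htower 1)
  have hper := periodTransfer_three_of_optimal_of_not_addv W₀ hM hN D₀ hopt hnA
  by_cases htam : 3 ∣ W₀.tamagawaProduct
  · exact deepLower_conclusion_of_missingLowerBoundAt_of_tamagawa_le_deepInfty W₀ 3 D₀.f hGZK
      (by norm_num) hirr hf hord hper (hL W₀ htower hr0 hnA) (hTD W₀ htower D₀.f hf hord hnA htam)
  · exact deepLower_conclusion_of_missingLowerBoundAt_of_not_dvd_tamagawa W₀ 3 D₀.f hGZK (by norm_num)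
      hirr hf hord hper (hL W₀ htower hr0 hnA) htam

/-- ★ **`stub_nonAdditive` on its COVERED sub-rows from SIX named facts + TamDiv-deep**: on the rows of
crux 19679 (binders verbatim, `¬ Addv W₀ 3`) that are good ORDINARY at `3` (row C16: `hYZ`, `hW20`) or
multiplicative at `3` WITH (ram) (row C1: `hSk`), with `hmod`, `hGZK`, `hM`, the LOWER conclusion follows
from TamDiv-deep at the row, asked only when `3 ∣ ∏ c_ℓ`. Gap to the registered stub: (i) TamDiv-deep on
the `3 ∣ ∏ c_ℓ` rows, OPEN; (ii) good SUPERSINGULAR `3` and multiplicative `3` WITHOUT (ram), where not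
even the lower half of `BSD₃` is in the tree. [cite: YanZhu2024MainConjNonCM, Thm. 4.15 (§4.6)]
[cite: Skinner2016PacificMC, Thm. C (§1)] [cite: Mazur1978, Cor. 4.1] [cite: Kim2022StructureSelmer, Conj. 1.10 (PDF p. 8)] -/
theorem stub_nonAdditive_covered_of_tamagawa_le_deepInfty
    (hYZ : YanZhu2026.thm415_padicValRat_bsd_rank_le_one)
    (hW20 : Wuthrich2014.lemma20_surjective_threeAdic_of_semistable)
    (hSk : Skinner2016.thmC_padicValRat_bsd_rank_zero)
    (hmod : hasEntireLFunction_rat) (hGZK : rank_eq_analyticRank_of_analyticRank_le_one)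
    (hM : mazur_not_dvd_maninConstant_of_odd) :
    ∀ (W₀ : WeierstrassCurve ℚ) [W₀.IsElliptic] [W₀.IsGloballyMinimal],
      (∀ n : ℕ, W₀.HasSurjectiveModNGaloisRep (3 ^ n : ℕ)) → Finite W₀.sha →
      ∀ {N : ℕ} [NeZero N], N = W₀.conductorNorm ℤ →
      ∀ (D₀ : ModularParametrizationData W₀ N),
        (∀ z ∈ D₀.L.lattice, ∃ w ∈ periodLattice D₀.f, z = D₀.c * w) →
        (∀ (W₂ : WeierstrassCurve ℚ) [W₂.IsElliptic] (D₂ : ModularParametrizationData W₂ N),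
          D₂.f = D₀.f → D₀.modularDegree ≤ D₂.modularDegree) →
        (∀ r : ℚ, ratPlusSymbol D₀.f r ≠ 0 → 0 ≤ padicValRat 3 (ratPlusSymbol D₀.f r)) →
        kuriharaVanishingOrder W₀ 3 D₀.f = 0 →
        ¬ (haveI : Fact (Nat.Prime 3) := ⟨Nat.prime_three⟩; Addv W₀ 3) →
        -- the covered sub-rows: ordinary if good, (ram) if multiplicative
        (W₀.HasGoodReductionAtPrime 3 → ¬ (3 : ℤ) ∣ W₀.frobeniusTrace 3) →
        (W₀.HasMultiplicativeReductionAtPrime 3 →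
          (haveI : Fact (Nat.Prime 3) := ⟨Nat.prime_three⟩; Ram W₀ 3)) →
        -- TamDiv-deep at the row, asked only when `3 ∣ ∏ c_ℓ`
        (3 ∣ W₀.tamagawaProduct →
          ((padicValNat 3 W₀.tamagawaProduct : ℕ) : ℕ∞) ≤ kuriharaPartialDeepInfty W₀ 3 D₀.f) →
        ∃ d : ℕ, kuriharaPartialDeepInfty W₀ 3 D₀.f = d ∧
          kuriharaPartial W₀ 3 D₀.f 0 ≤
            ((padicValNat 3 (Nat.card (AddCommGroup.primaryComponent W₀.sha 3)) + d : ℕ) : ℕ∞) := by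
  intro W₀ _ _ htower _ N _ hN D₀ hopt _ _ hord hnA hordinary hram hTD
  haveI : Fact (Nat.Prime 3) := ⟨Nat.prime_three⟩
  have hf : IsNewformOf W₀ D₀.f := D₀.isNewformOf
  have hr0 : W₀.analyticRank = 0 := analyticRank_eq_zero_of_kuriharaVanishingOrder_eq_zero W₀ D₀.f hf hord
  have hirr : W₀.HasIrreducibleModPGaloisRep 3 :=
    hasIrreducibleModPGaloisRep_of_hasSurjectiveModNGaloisRep W₀ 3 (by simpa using htower 1)
  have hper := periodTransfer_three_of_optimal_of_not_addv W₀ hM hN D₀ hopt hnA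
  have hlow : MissingLowerBoundAt W₀ 3 :=
    missingLowerBoundAt_three_covered W₀ hYZ hW20 hSk hmod hGZK htower hr0 hnA hordinary hram
  by_cases htam : 3 ∣ W₀.tamagawaProduct
  · exact deepLower_conclusion_of_missingLowerBoundAt_of_tamagawa_le_deepInfty W₀ 3 D₀.f hGZK
      (by norm_num) hirr hf hord hper hlow (hTD htam)
  · exact deepLower_conclusion_of_missingLowerBoundAt_of_not_dvd_tamagawa W₀ 3 D₀.f hGZK (by norm_num)
      hirr hf hord hper hlow htam

/-- ★ **`stub_nonAdditive` OUTRIGHT — named facts only, no open hypothesis — on the covered sub-rows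
with `3 ∤ ∏ c_ℓ`** (good ordinary `3`, or multiplicative `3` with (ram); Tamagawa product prime to `3`):
the six facts of `stub_nonAdditive_covered_of_tamagawa_le_deepInfty`, TamDiv-deep being vacuous.
[cite: YanZhu2024MainConjNonCM, Thm. 4.15 (§4.6)] [cite: Skinner2016PacificMC, Thm. C (§1)] [cite: Mazur1978, Cor. 4.1]
[cite: Miller2011LMS, Def. 1.1] -/
theorem stub_nonAdditive_covered_of_not_three_dvd_tamagawa
    (hYZ : YanZhu2026.thm415_padicValRat_bsd_rank_le_one)
    (hW20 : Wuthrich2014.lemma20_surjective_threeAdic_of_semistable)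
    (hSk : Skinner2016.thmC_padicValRat_bsd_rank_zero)
    (hmod : hasEntireLFunction_rat) (hGZK : rank_eq_analyticRank_of_analyticRank_le_one)
    (hM : mazur_not_dvd_maninConstant_of_odd) :
    ∀ (W₀ : WeierstrassCurve ℚ) [W₀.IsElliptic] [W₀.IsGloballyMinimal],
      (∀ n : ℕ, W₀.HasSurjectiveModNGaloisRep (3 ^ n : ℕ)) → Finite W₀.sha →
      ∀ {N : ℕ} [NeZero N], N = W₀.conductorNorm ℤ →
      ∀ (D₀ : ModularParametrizationData W₀ N),
        (∀ z ∈ D₀.L.lattice, ∃ w ∈ periodLattice D₀.f, z = D₀.c * w) →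
        (∀ (W₂ : WeierstrassCurve ℚ) [W₂.IsElliptic] (D₂ : ModularParametrizationData W₂ N),
          D₂.f = D₀.f → D₀.modularDegree ≤ D₂.modularDegree) →
        (∀ r : ℚ, ratPlusSymbol D₀.f r ≠ 0 → 0 ≤ padicValRat 3 (ratPlusSymbol D₀.f r)) →
        kuriharaVanishingOrder W₀ 3 D₀.f = 0 →
        ¬ (haveI : Fact (Nat.Prime 3) := ⟨Nat.prime_three⟩; Addv W₀ 3) →
        (W₀.HasGoodReductionAtPrime 3 → ¬ (3 : ℤ) ∣ W₀.frobeniusTrace 3) →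
        (W₀.HasMultiplicativeReductionAtPrime 3 →
          (haveI : Fact (Nat.Prime 3) := ⟨Nat.prime_three⟩; Ram W₀ 3)) →
        ¬ 3 ∣ W₀.tamagawaProduct →
        ∃ d : ℕ, kuriharaPartialDeepInfty W₀ 3 D₀.f = d ∧
          kuriharaPartial W₀ 3 D₀.f 0 ≤
            ((padicValNat 3 (Nat.card (AddCommGroup.primaryComponent W₀.sha 3)) + d : ℕ) : ℕ∞) := by
  intro W₀ _ _ htower hfin N _ hN D₀ hopt hdeg hint hord hnA hordinary hram htam
  exact stub_nonAdditive_covered_of_tamagawa_le_deepInfty hYZ hW20 hSk hmod hGZK hM W₀ htower hfin hN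
    D₀ hopt hdeg hint hord hnA hordinary hram (fun h => absurd h htam)

/-- ★ **`stub_nonAdditive` on the row-C1 sub-rows from NUMBERED THEOREMS only (+ TamDiv-deep)**: good
ORDINARY or multiplicative `3` WITH Skinner's (ram) witness; inputs `hSU`, `hA`, `hGr`, `hJs`, `hJn`,
`hGS`, `hM`, `hmod`, `hpar`, `hGZK` of `missingLowerBoundAt_three_of_rowC1_of_mainConjectures_of_mazur` —
no PRE input (at `3`, `hSU` / `hA` carry the PUB* token `SU14-12.3.6-mu@nonsplit@3`, planner R-01, evidence #6 on
item 19679); TamDiv-deep asked only when `3 ∣ ∏ c_ℓ`.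
[cite: SkinnerUrban2014, Thm. 3.6.9 (p. 45)] [cite: Skinner2016PacificMC, Thm. A, §3.2–3.3]
[cite: GreenbergLNM1716, Thm. 4.1 (p. 102)] [cite: Mazur1978, Cor. 4.1] [cite: Kim2022StructureSelmer, Conj. 1.10 (PDF p. 8)] -/
theorem stub_nonAdditive_rowC1_of_mainConjectures_of_mazur
    (hSU : ∀ (W : WeierstrassCurve ℚ) [W.IsElliptic] [W.IsGloballyMinimal] (p : ℕ) [Fact p.Prime]
      (κ : ZpExtension ℚ p) (γ : Field.absoluteGaloisGroup ℚ) (N : ℕ) [NeZero N]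
      (f : CuspForm (Gamma0 N) 2),
      skinner_urban_main_conjecture W p (κ := κ) (γ := γ) (f := f))
    (hA : thmA_charIdeal_multiplicative) (hGr : greenberg_charValue_rankZero)
    (hJs : thm61_splitMultiplicative) (hJn : thm61_nonsplitMultiplicative)
    (hGS : ∀ (W : WeierstrassCurve ℚ) [W.IsElliptic] [W.IsGloballyMinimal] (p : ℕ) [Fact p.Prime],
      greenberg_stevens (W := W) (p := p))
    (hM : mazur_not_dvd_maninConstant_of_odd)
    (hmod : hasEntireLFunction_rat) (hpar : nonempty_modularParametrizationData)
    (hGZK : rank_eq_analyticRank_of_analyticRank_le_one) :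
    ∀ (W₀ : WeierstrassCurve ℚ) [W₀.IsElliptic] [W₀.IsGloballyMinimal],
      (∀ n : ℕ, W₀.HasSurjectiveModNGaloisRep (3 ^ n : ℕ)) → Finite W₀.sha →
      ∀ {N : ℕ} [NeZero N], N = W₀.conductorNorm ℤ →
      ∀ (D₀ : ModularParametrizationData W₀ N),
        (∀ z ∈ D₀.L.lattice, ∃ w ∈ periodLattice D₀.f, z = D₀.c * w) →
        (∀ (W₂ : WeierstrassCurve ℚ) [W₂.IsElliptic] (D₂ : ModularParametrizationData W₂ N),
          D₂.f = D₀.f → D₀.modularDegree ≤ D₂.modularDegree) →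
        (∀ r : ℚ, ratPlusSymbol D₀.f r ≠ 0 → 0 ≤ padicValRat 3 (ratPlusSymbol D₀.f r)) →
        kuriharaVanishingOrder W₀ 3 D₀.f = 0 →
        ¬ (haveI : Fact (Nat.Prime 3) := ⟨Nat.prime_three⟩; Addv W₀ 3) →
        (W₀.HasGoodReductionAtPrime 3 → ¬ (3 : ℤ) ∣ W₀.frobeniusTrace 3) →
        (haveI : Fact (Nat.Prime 3) := ⟨Nat.prime_three⟩; Ram W₀ 3) →
        (3 ∣ W₀.tamagawaProduct →
          ((padicValNat 3 W₀.tamagawaProduct : ℕ) : ℕ∞) ≤ kuriharaPartialDeepInfty W₀ 3 D₀.f) →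
        ∃ d : ℕ, kuriharaPartialDeepInfty W₀ 3 D₀.f = d ∧
          kuriharaPartial W₀ 3 D₀.f 0 ≤
            ((padicValNat 3 (Nat.card (AddCommGroup.primaryComponent W₀.sha 3)) + d : ℕ) : ℕ∞) := by
  intro W₀ _ _ htower _ N _ hN D₀ hopt _ _ hord hnA hordinary hram hTD
  haveI : Fact (Nat.Prime 3) := ⟨Nat.prime_three⟩
  have hf : IsNewformOf W₀ D₀.f := D₀.isNewformOf
  have hr0 : W₀.analyticRank = 0 := analyticRank_eq_zero_of_kuriharaVanishingOrder_eq_zero W₀ D₀.f hf hord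
  have hirr : W₀.HasIrreducibleModPGaloisRep 3 :=
    hasIrreducibleModPGaloisRep_of_hasSurjectiveModNGaloisRep W₀ 3 (by simpa using htower 1)
  have hper := periodTransfer_three_of_optimal_of_not_addv W₀ hM hN D₀ hopt hnA
  have hred : (W₀.HasGoodReductionAtPrime 3 ∧ ¬ (3 : ℤ) ∣ W₀.frobeniusTrace 3) ∨
      W₀.HasMultiplicativeReductionAtPrime 3 := by
    by_cases hgood : W₀.HasGoodReductionAtPrime 3
    · exact Or.inl ⟨hgood, hordinary hgood⟩
    · right
      by_contra h
      exact hnA ⟨hgood, h⟩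
  have hlow : MissingLowerBoundAt W₀ 3 :=
    missingLowerBoundAt_three_of_rowC1_of_mainConjectures_of_mazur W₀ hSU hA hGr hJs hJn hGS hM hmod
      hpar hGZK hr0 hirr hred hram
  by_cases htam : 3 ∣ W₀.tamagawaProduct
  · exact deepLower_conclusion_of_missingLowerBoundAt_of_tamagawa_le_deepInfty W₀ 3 D₀.f hGZK
      (by norm_num) hirr hf hord hper hlow (hTD htam)
  · exact deepLower_conclusion_of_missingLowerBoundAt_of_not_dvd_tamagawa W₀ 3 D₀.f hGZK (by norm_num)
      hirr hf hord hper hlow htam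

/-- **Necessity in the crux's currency: on the covered sub-rows the stub's row conclusion IMPLIES
TamDiv-deep** (`BSDp W₀ 3` by name gives Miller's upper half; §1): so on C1 ∪ C16 the registered stub is
EQUIVALENT to «`3^{v₃(∏ c_ℓ)}` divides every Kurihara number of `D₀.f` at deep cyclic levels» — its exact
residue there. [cite: YanZhu2024MainConjNonCM, Thm. 4.15 (§4.6)] [cite: Skinner2016PacificMC, Thm. C (§1)]
[cite: Kim2022StructureSelmer, Conj. 1.10 (PDF p. 8)] [cite: Mazur1978, Cor. 4.1] -/
theorem tamagawa_le_deepInfty_of_stubRow_covered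
    (hYZ : YanZhu2026.thm415_padicValRat_bsd_rank_le_one)
    (hW20 : Wuthrich2014.lemma20_surjective_threeAdic_of_semistable)
    (hSk : Skinner2016.thmC_padicValRat_bsd_rank_zero)
    (hmod : hasEntireLFunction_rat) (hGZK : rank_eq_analyticRank_of_analyticRank_le_one)
    (hM : mazur_not_dvd_maninConstant_of_odd)
    (W₀ : WeierstrassCurve ℚ) [W₀.IsElliptic] [W₀.IsGloballyMinimal]
    (htower : ∀ n : ℕ, W₀.HasSurjectiveModNGaloisRep (3 ^ n : ℕ))
    {N : ℕ} [NeZero N] (hN : N = W₀.conductorNorm ℤ) (D₀ : ModularParametrizationData W₀ N)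
    (hopt : ∀ z ∈ D₀.L.lattice, ∃ w ∈ periodLattice D₀.f, z = D₀.c * w)
    (hord : kuriharaVanishingOrder W₀ 3 D₀.f = 0)
    (hnA : ¬ (haveI : Fact (Nat.Prime 3) := ⟨Nat.prime_three⟩; Addv W₀ 3))
    (hordinary : W₀.HasGoodReductionAtPrime 3 → ¬ (3 : ℤ) ∣ W₀.frobeniusTrace 3)
    (hram : W₀.HasMultiplicativeReductionAtPrime 3 →
      (haveI : Fact (Nat.Prime 3) := ⟨Nat.prime_three⟩; Ram W₀ 3))
    (hrow : ∃ d : ℕ, kuriharaPartialDeepInfty W₀ 3 D₀.f = d ∧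
      kuriharaPartial W₀ 3 D₀.f 0 ≤
        ((padicValNat 3 (Nat.card (AddCommGroup.primaryComponent W₀.sha 3)) + d : ℕ) : ℕ∞)) :
    ((padicValNat 3 W₀.tamagawaProduct : ℕ) : ℕ∞) ≤ kuriharaPartialDeepInfty W₀ 3 D₀.f := by
  haveI : Fact (Nat.Prime 3) := ⟨Nat.prime_three⟩
  have hf : IsNewformOf W₀ D₀.f := D₀.isNewformOf
  have hr0 : W₀.analyticRank = 0 := analyticRank_eq_zero_of_kuriharaVanishingOrder_eq_zero W₀ D₀.f hf hord
  have hirr : W₀.HasIrreducibleModPGaloisRep 3 :=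
    hasIrreducibleModPGaloisRep_of_hasSurjectiveModNGaloisRep W₀ 3 (by simpa using htower 1)
  have hup : MissingUpperBoundAt W₀ 3 := by
    by_cases hgood : W₀.HasGoodReductionAtPrime 3
    · exact KimAtThreeDeepUpperNonAdditiveRows.missingUpperBoundAt_three_of_goodOrd_of_towerSurj hYZ hW20
        hmod hGZK W₀ htower hr0 hgood (hordinary hgood)
    · have hmult : W₀.HasMultiplicativeReductionAtPrime 3 := by
        by_contra h
        exact hnA ⟨hgood, h⟩
      exact KimAtThreeDeepUpperNonAdditiveRows.missingUpperBoundAt_three_of_mult_of_ram hSk hmod hGZK W₀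
        htower hr0 hmult (hram hmult)
  exact tamagawa_le_deepInfty_of_lowerRow_of_missingUpperBoundAt W₀ 3 D₀.f hGZK (by norm_num) hirr hf
    hord (periodTransfer_three_of_optimal_of_not_addv W₀ hM hN D₀ hopt hnA) hup hrow


/-! ### §2 Both deep twins on a `BSD₃` row: Kim's Conjecture 1.10 in the deep reading, exactly -/

section Twins

variable (W : WeierstrassCurve ℚ) [W.IsElliptic] [W.IsGloballyMinimal] (p : ℕ) [Fact p.Prime]
  {N : ℕ} [NeZero N] (f : CuspForm (Gamma0 N) 2)

/-- **GIVEN `BSD_p` at the row, the two deep twins (crux 19679's LOWER `a ≤ s + d` ∧ crux 19562's UPPER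
`s + d ≤ a`, i.e. Kim's deep formula `s = a − d`) hold iff `∂^{(∞)}_{deep}(δ̃) = v_p(∏ c_ℓ)` EXACTLY** —
Kim 2022 Conj. 1.10 in its deep reading (odd `p`, `E[p]` irreducible, newform `f`, analytic rank `0`,
period transfer, GZK): `→` by §1 of the companion file (`c ≤ d`) and w2-c5's
`deepUpper_conclusion_iff_deepInfty_le_tamagawa_of_missingPPartAt` (`d ≤ c`); `←` by the two sockets.
So on a `BSD(E,p)`-known row the off-stratum deep pair {19679, 19562} IS Conj. 1.10 (deep), no more, no less.
[cite: Kim2022StructureSelmer, Conj. 1.10 (PDF p. 8), Thm. 1.9 (6)] [cite: Miller2011LMS, Def. 1.1] -/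
theorem deepTwins_iff_deepInfty_eq_tamagawa_of_missingPPartAt
    (hGZK : rank_eq_analyticRank_of_analyticRank_le_one) (hp2 : p ≠ 2)
    (hirr : W.HasIrreducibleModPGaloisRep p) (hf : IsNewformOf W f)
    (hord : kuriharaVanishingOrder W p f = 0)
    (hper : ∃ u : ℚ, ‖(u : ℚ_[p])‖ = 1 ∧ W.realPeriodRat = u * plusPeriod f)
    (hbsd : MissingPPartAt W p) :
    ((∃ d : ℕ, kuriharaPartialDeepInfty W p f = d ∧
        kuriharaPartial W p f 0 ≤
          ((padicValNat p (Nat.card (AddCommGroup.primaryComponent W.sha p)) + d : ℕ) : ℕ∞)) ∧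
      (∃ d : ℕ, kuriharaPartialDeepInfty W p f = d ∧
        ((padicValNat p (Nat.card (AddCommGroup.primaryComponent W.sha p)) + d : ℕ) : ℕ∞) ≤
          kuriharaPartial W p f 0)) ↔
      kuriharaPartialDeepInfty W p f = ((padicValNat p W.tamagawaProduct : ℕ) : ℕ∞) := by
  have hLiff := deepLower_conclusion_iff_tamagawa_le_deepInfty_of_missingPPartAt W p f hGZK hp2 hirr hf
    hord hper hbsd
  have hUiff := KimAtThreeDeepUpperNonAdditiveRows.deepUpper_conclusion_iff_deepInfty_le_tamagawa_of_missingPPartAt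
    W p f hGZK hp2 hirr hf hord hper hbsd
  constructor
  · rintro ⟨hL, hU⟩
    exact le_antisymm (hUiff.mp hU) (hLiff.mp hL)
  · intro h
    exact ⟨hLiff.mpr h.ge, hUiff.mpr h.le⟩

end Twins

/-- **On the covered non-additive rows of crux 19679 / 19562 (ORDINARY if good, (ram) if multiplicative;
crux binders, optimal datum), the two registered `stub_nonAdditive` conclusions TOGETHER are EQUIVALENT to
`∂^{(∞)}_{deep}(δ̃) = v₃(∏ c_ℓ)`** — by name from `hYZ`, `hW20`, `hSk`, `hmod`, `hGZK`, `hM` (`BSDp W₀ 3` on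
rows C16 / C1, period transfer free). The off-stratum deep pair's exact content on its covered rows.
[cite: YanZhu2024MainConjNonCM, Thm. 4.15 (§4.6)] [cite: Skinner2016PacificMC, Thm. C (§1)] [cite: Mazur1978, Cor. 4.1]
[cite: Kim2022StructureSelmer, Conj. 1.10 (PDF p. 8)] -/
theorem deepTwins_covered_iff_deepInfty_eq_tamagawa
    (hYZ : YanZhu2026.thm415_padicValRat_bsd_rank_le_one)
    (hW20 : Wuthrich2014.lemma20_surjective_threeAdic_of_semistable)
    (hSk : Skinner2016.thmC_padicValRat_bsd_rank_zero)
    (hmod : hasEntireLFunction_rat) (hGZK : rank_eq_analyticRank_of_analyticRank_le_one)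
    (hM : mazur_not_dvd_maninConstant_of_odd)
    (W₀ : WeierstrassCurve ℚ) [W₀.IsElliptic] [W₀.IsGloballyMinimal]
    (htower : ∀ n : ℕ, W₀.HasSurjectiveModNGaloisRep (3 ^ n : ℕ))
    {N : ℕ} [NeZero N] (hN : N = W₀.conductorNorm ℤ) (D₀ : ModularParametrizationData W₀ N)
    (hopt : ∀ z ∈ D₀.L.lattice, ∃ w ∈ periodLattice D₀.f, z = D₀.c * w)
    (hord : kuriharaVanishingOrder W₀ 3 D₀.f = 0)
    (hnA : ¬ (haveI : Fact (Nat.Prime 3) := ⟨Nat.prime_three⟩; Addv W₀ 3))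
    (hordinary : W₀.HasGoodReductionAtPrime 3 → ¬ (3 : ℤ) ∣ W₀.frobeniusTrace 3)
    (hram : W₀.HasMultiplicativeReductionAtPrime 3 →
      (haveI : Fact (Nat.Prime 3) := ⟨Nat.prime_three⟩; Ram W₀ 3)) :
    ((∃ d : ℕ, kuriharaPartialDeepInfty W₀ 3 D₀.f = d ∧
        kuriharaPartial W₀ 3 D₀.f 0 ≤
          ((padicValNat 3 (Nat.card (AddCommGroup.primaryComponent W₀.sha 3)) + d : ℕ) : ℕ∞)) ∧
      (∃ d : ℕ, kuriharaPartialDeepInfty W₀ 3 D₀.f = d ∧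
        ((padicValNat 3 (Nat.card (AddCommGroup.primaryComponent W₀.sha 3)) + d : ℕ) : ℕ∞) ≤
          kuriharaPartial W₀ 3 D₀.f 0)) ↔
      kuriharaPartialDeepInfty W₀ 3 D₀.f = ((padicValNat 3 W₀.tamagawaProduct : ℕ) : ℕ∞) := by
  haveI : Fact (Nat.Prime 3) := ⟨Nat.prime_three⟩
  have hf : IsNewformOf W₀ D₀.f := D₀.isNewformOf
  have hr0 : W₀.analyticRank = 0 := analyticRank_eq_zero_of_kuriharaVanishingOrder_eq_zero W₀ D₀.f hf hord
  have hsurj : Surj W₀ 3 := by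
    have h := htower 1
    rw [pow_one] at h
    exact h
  have hirr : Irr W₀ 3 := hasIrreducibleModPGaloisRep_of_hasSurjectiveModNGaloisRep W₀ 3 hsurj
  haveI : Finite W₀.sha := (hGZK W₀ (by rw [hr0]; exact zero_le_one)).2
  have hbsd : BSDp W₀ 3 := by
    by_cases hgood : W₀.HasGoodReductionAtPrime 3
    · have hC16 : RowC16 W₀ 3 := ⟨rfl, ⟨hgood, by exact_mod_cast hordinary hgood⟩, hirr, Or.inl hsurj⟩
      exact RowC16.bsdp hYZ hW20 hmod hGZK (by rw [hr0]; exact zero_le_one) hC16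
    · have hmult : W₀.HasMultiplicativeReductionAtPrime 3 := by
        by_contra h
        exact hnA ⟨hgood, h⟩
      exact RowC1.bsdp hSk hmod hGZK ⟨hr0, le_rfl, Or.inr hmult, hirr, hram hmult⟩
  exact deepTwins_iff_deepInfty_eq_tamagawa_of_missingPPartAt W₀ 3 D₀.f hGZK (by norm_num) hirr hf hord
    (periodTransfer_three_of_optimal_of_not_addv W₀ hM hN D₀ hopt hnA) (missingPPartAt_of_bsdp W₀ 3 hbsd)

end Summit.BirchSwinnertonDyer.BirchSwinnertonDyer.Theorems.KimAtThreeDeepLowerOffStratumNonAdditiveRows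

end
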